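import Mathlib
import Summits.QuantumAdvantage.QuantumAdvantage.Theorems.MobiusLadderQuadraticDigitPhasesStubDwdOfWords

/-!
# LOW-cut Kátai: the assembly (`stub_lowCutKatai_asm`)

Stub `stub_lowCutKatai_asm` of the crux `MobiusLadder.QuadraticDigitPhases` (stmt-QuantumAdvantage-1391),
line `Sketch`: the bookkeeping that turns

* `hBlock` — an aligned dyadic block sum (length `2^N`) of the Kátai product phase is bounded by the
  `ℓ¹` quantity `L1(p, q, n, N, P)` of the reduced carry/pending-form states,
* `hUwc` — for distinct odd primes `p, q`, a cut-rank bound `R₀` and `δ > 0` there are `s, g` such that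
  `g` sequential far pairs (`span > s`, readers `k_t < N`) force `L1 ≤ δ 2^N`,
* `hStruct` — cut rank `< R₀` everywhere and not `(R, s)`-low give `g'` sequential far pairs with
  `R ≤ R₀ g'`,

into the LOW-cut Kátai bound `|Σ_{m ≤ M} F_p(m) F_q(m)| ≤ τ M` for `2^n ≤ 2BM`, `M ≤ 2^n`.

The proof is `stub_lowCutKatai_abs`, stated for abstract `F, L1, cut, low, good` (the concrete, very long, expressions are
substituted only in the last step).  Parameters (given `B, τ, R₀`): `δ = τ/(16B)`, `2^L > 16B/τ`; for every
pair in `range (B+1)²` thresholds `(s_pq, g_pq)` from `hUwc` (`choose` + `Finset.sup`), `s = sup s_pq + L`,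
`G = sup g_pq`, `R = R₀ G + 1` (so `R ≤ R₀ g'` forces `g' > G`).  For fixed `n, P, p, q, M`: the far pairs
are `k`-increasing with `k_t ≤ b_{t+1}` and `b_{t+1} + s < k_{t+1} < n`, so the first `g' - 1 ≥ G ≥ g_pq`
readers lie below `i₀ = n - L`; hence every aligned block of level `i ≥ i₀` costs `≤ δ 2^i`
(`hBlock` + `hUwc` at `N = i`), shorter blocks cost `≤ 2^i`, and the dyadic cover
`…StubDwdOfWords.abs_sum_Ico_le_cover` gives `|Σ_{Ico 1 M}| ≤ 2 (2^{i₀} + 2 δ 2^n) ≤ τM/4 + τM/2`;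
the last term `m = M` costs `1 < τM/8` (`τ M ≥ τ 2^n/(2B) > 8`).
-/

set_option linter.dupNamespace false -- D-0017: single-problem summit ⇒ `QuantumAdvantage.QuantumAdvantage` by design

namespace Summit.QuantumAdvantage.QuantumAdvantage.Theorems.MobiusLadderQuadraticDigitPhasesStubLowCutKataiAsm

open Finset

/-- The assembly in ABSTRACT form (registered stub `stub_lowCutKatai_abs`; its signature is kept short so that the
ledger can register it verbatim — the concrete one below exceeds the registry's 4000-character limit): `F n P p m` is the
phase `(-1)^{P(bits(p m))}` (only `|F| ≤ 1` is used), `L1 n P p q N` the `ℓ¹` state quantity, `cut n P R₀` the cut-rank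
bound, `low n P R s` the `(R, s)`-low property and `good n P b k` "the coefficient of `x_b x_k` is nonzero".  From the
block bound, the contraction and the structure theorem we get the LOW-cut Kátai bound with `R = R₀ G + 1`,
`s = sup s_pq + L` (see the module docstring for the computation). -/
theorem stub_lowCutKatai_abs :
    ∀ (F : (n : ℕ) → MvPolynomial (Fin n) (ZMod 2) → ℕ → ℕ → ℝ)
      (L1 : (n : ℕ) → MvPolynomial (Fin n) (ZMod 2) → ℕ → ℕ → ℕ → ℝ)
      (cut : (n : ℕ) → MvPolynomial (Fin n) (ZMod 2) → ℕ → Prop)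
      (low : (n : ℕ) → MvPolynomial (Fin n) (ZMod 2) → ℕ → ℕ → Prop)
      (good : (n : ℕ) → MvPolynomial (Fin n) (ZMod 2) → ℕ → ℕ → Prop),
    (∀ n P p m, |F n P p m| ≤ 1) →
    (∀ (p q n N : ℕ) (P : MvPolynomial (Fin n) (ZMod 2)), P.totalDegree ≤ 2 → N ≤ n → 0 < p → 0 < q → ∀ mhi : ℕ,
      |∑ T ∈ Finset.range (2 ^ N), F n P p (mhi * 2 ^ N + T) * F n P q (mhi * 2 ^ N + T)| ≤ L1 n P p q N) →
    (∀ p q : ℕ, p.Prime → q.Prime → p ≠ q → 2 < p → 2 < q → ∀ R₀ : ℕ, ∀ δ : ℝ, 0 < δ →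
      ∃ s g : ℕ, ∀ (n N : ℕ) (P : MvPolynomial (Fin n) (ZMod 2)), N ≤ n → cut n P R₀ →
      (∃ b k : ℕ → ℕ, (∀ t, t < g → b t < k t ∧ k t < N ∧ s < k t - b t ∧ good n P (b t) (k t)) ∧
        (∀ t, t + 1 < g → k t ≤ b (t + 1))) → L1 n P p q N ≤ δ * (2 : ℝ) ^ N) →
    (∀ (n R₀ R s : ℕ) (P : MvPolynomial (Fin n) (ZMod 2)), P.totalDegree ≤ 2 → cut n P R₀ → ¬ low n P R s →
      ∃ (g : ℕ) (b k : ℕ → ℕ), R ≤ R₀ * g ∧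
        (∀ t, t < g → b t < k t ∧ k t < n ∧ s < k t - b t ∧ good n P (b t) (k t)) ∧
        (∀ t, t + 1 < g → k t ≤ b (t + 1))) →
    ∀ B : ℕ, ∀ τ : ℝ, 0 < τ → ∀ R₀ : ℕ, ∃ R s : ℕ, ∀ n : ℕ, ∀ P : MvPolynomial (Fin n) (ZMod 2),
      P.totalDegree ≤ 2 → cut n P R₀ → ¬ low n P R s →
      ∀ p q : ℕ, p.Prime → q.Prime → p ≠ q → 2 < p → 2 < q → p ≤ B → q ≤ B →
      ∀ M : ℕ, M ≤ 2 ^ n → 2 ^ n ≤ 2 * B * M →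
        |∑ m ∈ Finset.Icc 1 M, F n P p m * F n P q m| ≤ τ * M := by
  intro F L1 cut low good hF1 hBlock hUwc hStruct B τ hτ R₀
  classical
  rcases Nat.eq_zero_or_pos B with rfl | hB
  · exact ⟨0, 0, fun n P _ _ _ p q hp _ _ hp2 _ hpB => absurd hpB (by omega)⟩
  have hBr : (0 : ℝ) < B := by exact_mod_cast hB
  set δ : ℝ := τ / (16 * B) with hδ
  have hδpos : 0 < δ := by positivity
  obtain ⟨L, hL⟩ := pow_unbounded_of_one_lt (16 * (B : ℝ) / τ) (one_lt_two (α := ℝ))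
  -- one pair of thresholds `(s, g)` for every admissible pair of primes
  have hpair : ∀ pq : ℕ × ℕ, ∃ sg : ℕ × ℕ,
      (pq.1.Prime ∧ pq.2.Prime ∧ pq.1 ≠ pq.2 ∧ 2 < pq.1 ∧ 2 < pq.2) →
      ∀ (n N : ℕ) (P : MvPolynomial (Fin n) (ZMod 2)), N ≤ n → cut n P R₀ →
      (∃ b k : ℕ → ℕ, (∀ t, t < sg.2 → b t < k t ∧ k t < N ∧ sg.1 < k t - b t ∧ good n P (b t) (k t)) ∧
        (∀ t, t + 1 < sg.2 → k t ≤ b (t + 1))) → L1 n P pq.1 pq.2 N ≤ δ * (2 : ℝ) ^ N := by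
    rintro ⟨p, q⟩
    by_cases h : p.Prime ∧ q.Prime ∧ p ≠ q ∧ 2 < p ∧ 2 < q
    · obtain ⟨s, g, hsg⟩ := hUwc p q h.1 h.2.1 h.2.2.1 h.2.2.2.1 h.2.2.2.2 R₀ δ hδpos
      exact ⟨(s, g), fun _ => hsg⟩
    · exact ⟨(0, 0), fun h' => absurd h' h⟩
  choose sg hsg using hpair
  obtain ⟨S, hSL, hSall⟩ : ∃ S : ℕ, L ≤ S ∧ ∀ pq ∈ range (B + 1) ×ˢ range (B + 1), (sg pq).1 ≤ S :=
    ⟨(range (B + 1) ×ˢ range (B + 1)).sup (fun pq => (sg pq).1) + L, Nat.le_add_left _ _,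
      fun pq hpq => (Finset.le_sup (f := fun pq => (sg pq).1) hpq).trans (Nat.le_add_right _ _)⟩
  obtain ⟨G, hGall⟩ : ∃ G : ℕ, ∀ pq ∈ range (B + 1) ×ˢ range (B + 1), (sg pq).2 ≤ G :=
    ⟨(range (B + 1) ×ˢ range (B + 1)).sup (fun pq => (sg pq).2),
      fun pq hpq => Finset.le_sup (f := fun pq => (sg pq).2) hpq⟩
  refine ⟨R₀ * G + 1, S, ?_⟩
  intro n P hP hcut hnot p q hp hq hne hp2 hq2 hpB hqB M hM hBM
  obtain ⟨g', b, k, hR, hpairs, hchain⟩ := hStruct n R₀ (R₀ * G + 1) S P hP hcut hnot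
  have hGg : G < g' := Nat.lt_of_mul_lt_mul_left (Nat.lt_of_succ_le hR)
  have hmem : (p, q) ∈ range (B + 1) ×ˢ range (B + 1) := by
    simp only [Finset.mem_product, Finset.mem_range]; omega
  have hs0 := hSall (p, q) hmem
  have hg0 := hGall (p, q) hmem
  -- `n` is large: the first far pair fits below `n`
  have hLn : L < n := by
    obtain ⟨h01, h02, h03, -⟩ := hpairs 0 (by omega)
    omega
  set i₀ : ℕ := n - L with hi₀
  set f : ℕ → ℝ := fun m => F n P p m * F n P q m with hf
  have hf1 : ∀ m, |f m| ≤ 1 := fun m => by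
    simp only [hf, abs_mul]
    exact mul_le_one₀ (hF1 n P p m) (abs_nonneg _) (hF1 n P q m)
  -- aligned dyadic blocks: trivially `≤ 2^i`, and `≤ δ 2^i` from level `i₀` on
  have hKey : ∀ i x, i ≤ n → |∑ T ∈ Ico (x * 2 ^ i) ((x + 1) * 2 ^ i), f T| ≤
      (if i < i₀ then (2 : ℝ) ^ i else 0) + δ * 2 ^ i := by
    intro i x hi
    rw [Finset.sum_Ico_eq_sum_range, show (x + 1) * 2 ^ i - x * 2 ^ i = 2 ^ i by
      rw [add_mul, one_mul, Nat.add_sub_cancel_left]]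
    by_cases hii : i < i₀
    · rw [if_pos hii]
      calc _ ≤ ∑ T ∈ range (2 ^ i), |f (x * 2 ^ i + T)| := Finset.abs_sum_le_sum_abs _ _
        _ ≤ ∑ T ∈ range (2 ^ i), (1 : ℝ) := Finset.sum_le_sum fun T _ => hf1 _
        _ = (2 : ℝ) ^ i := by simp
        _ ≤ _ := le_add_of_nonneg_right (by positivity)
    · rw [if_neg hii, zero_add]
      have hprs : ∃ b k : ℕ → ℕ, (∀ t, t < (sg (p, q)).2 → b t < k t ∧ k t < i ∧
          (sg (p, q)).1 < k t - b t ∧ good n P (b t) (k t)) ∧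
          (∀ t, t + 1 < (sg (p, q)).2 → k t ≤ b (t + 1)) := by
        refine ⟨b, k, fun t ht => ?_, fun t ht => hchain t (by omega)⟩
        have ht' : t + 1 < g' := by omega
        obtain ⟨h11, -, h13, h14⟩ := hpairs t (by omega)
        obtain ⟨-, h22, h23, -⟩ := hpairs (t + 1) ht'
        have h3 := hchain t ht'
        exact ⟨h11, by omega, by omega, h14⟩
      exact (hBlock p q n i P hP hi hp.pos hq.pos x).trans
        (hsg (p, q) ⟨hp, hq, hne, hp2, hq2⟩ n i P hi hcut hprs)
  -- the dyadic cover
  have hcov : ∀ b' : ℕ, b' ≤ 2 ^ n → |∑ T ∈ Ico 1 b', f T| ≤ 2 * (2 ^ i₀ + 2 * δ * 2 ^ n) := by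
    intro b' hb'
    have h := MobiusLadderQuadraticDigitPhasesStubDwdOfWords.abs_sum_Ico_le_cover _ n f hKey 1 b' hb'
    rw [Finset.sum_add_distrib] at h
    have hsum1 : ∑ i ∈ range (n + 1), (if i < i₀ then (2 : ℝ) ^ i else 0) ≤ 2 ^ i₀ := by
      rw [← Finset.sum_filter, show (range (n + 1)).filter (· < i₀) = range i₀ by
        ext j; simp only [Finset.mem_filter, Finset.mem_range]; omega,
        MobiusLadderQuadraticDigitPhasesStubDwdOfWords.sum_two_pow]
      linarith
    have hsum2 : ∑ i ∈ range (n + 1), δ * (2 : ℝ) ^ i ≤ 2 * δ * 2 ^ n := by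
      rw [← Finset.mul_sum, MobiusLadderQuadraticDigitPhasesStubDwdOfWords.sum_two_pow, pow_succ]
      nlinarith
    linarith
  -- split off the last term and conclude
  have hM1 : 1 ≤ M := by
    rcases Nat.eq_zero_or_pos M with rfl | h
    · rw [mul_zero] at hBM
      exact absurd hBM (Nat.pos_iff_ne_zero.mp (Nat.two_pow_pos n) ∘ Nat.le_zero.mp)
    · exact h
  rw [← Finset.Ico_insert_right hM1, Finset.sum_insert Finset.right_notMem_Ico]
  have hXY : (2 : ℝ) ^ i₀ * 2 ^ L = 2 ^ n := by
    rw [← pow_add]; congr 1; omega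
  have hBM' : (2 : ℝ) ^ n ≤ 2 * B * M := by exact_mod_cast hBM
  have h16 : 16 * (B : ℝ) < τ * 2 ^ L := by
    have := (div_lt_iff₀ hτ).mp hL; linarith
  have hLn' : (2 : ℝ) ^ L ≤ 2 ^ n := pow_le_pow_right₀ one_le_two hLn.le
  have ha : 16 * (B : ℝ) * 2 ^ i₀ < τ * (2 * B * M) := by
    calc 16 * (B : ℝ) * 2 ^ i₀ < τ * 2 ^ L * 2 ^ i₀ := by gcongr
      _ = τ * 2 ^ n := by rw [mul_assoc, mul_comm ((2 : ℝ) ^ L), hXY]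
      _ ≤ τ * (2 * B * M) := by gcongr
  have ha' : 16 * (2 : ℝ) ^ i₀ < τ * (2 * M) :=
    lt_of_mul_lt_mul_left (a := (B : ℝ)) (by linarith) hBr.le
  have hb : δ * (2 : ℝ) ^ n ≤ τ * M / 8 := by
    calc δ * (2 : ℝ) ^ n ≤ δ * (2 * B * M) := by gcongr
      _ = τ * M / 8 := by rw [hδ]; field_simp; ring
  have hc : 16 * (B : ℝ) < τ * (2 * B * M) := by nlinarith
  have hc' : (16 : ℝ) < τ * (2 * M) := lt_of_mul_lt_mul_left (a := (B : ℝ)) (by linarith) hBr.le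
  calc |f M + ∑ T ∈ Ico 1 M, f T| ≤ |f M| + |∑ T ∈ Ico 1 M, f T| := abs_add_le _ _
    _ ≤ 1 + 2 * (2 ^ i₀ + 2 * δ * 2 ^ n) := add_le_add (hf1 M) (hcov M hM)
    _ ≤ τ * M := by linarith

/-- ASSEMBLY of the LOW-cut Kátai bound (registered stub `stub_lowCutKatai_asm` of crux stmt-QuantumAdvantage-1391, line
Sketch, skeleton v22) from the block semantics `hBlock`, the width-`w` contraction core `hUwc` and the structure theorem
`hStruct`, via the dyadic cover `…StubDwdOfWords.abs_sum_Ico_le_cover`: this is `stub_lowCutKatai_abs` with the concrete phase,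
`ℓ¹` quantity, cut-rank, lowness and coefficient predicates substituted (the "earliest reader" clause of `hStruct`
is not used). -/
theorem stub_lowCutKatai_asm
    (hBlock : ∀ (p q n N : ℕ) (P : MvPolynomial (Fin n) (ZMod 2)), P.totalDegree ≤ 2 → N ≤ n → 0 < p → 0 < q → ∀ mhi : ℕ,
      |∑ T ∈ Finset.range (2 ^ N), (if MvPolynomial.eval (fun i : Fin n => if Nat.testBit (p * (mhi * 2 ^ N + T)) i then (1 : ZMod 2) else 0) P = 1 then (-1 : ℝ) else 1) *
          (if MvPolynomial.eval (fun i : Fin n => if Nat.testBit (q * (mhi * 2 ^ N + T)) i then (1 : ZMod 2) else 0) P = 1 then (-1 : ℝ) else 1)| ≤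
        (∑ x ∈ Finset.range p ×ˢ Finset.range q, ∑ π : Fin n → ZMod 2, ∑ π' : Fin n → ZMod 2,
          |∑ T ∈ (Finset.range (2 ^ N)).filter (fun T => (p * T / 2 ^ N = x.1 ∧ q * T / 2 ^ N = x.2 ∧ (fun j : Fin n => if N ≤ (j : ℕ) then ∑ i ∈ Finset.range N, (if h : i < n then MvPolynomial.coeff (Finsupp.single (⟨i, h⟩ : Fin n) 1 + Finsupp.single j 1) P else 0) * (if Nat.testBit (p * T) i then (1 : ZMod 2) else 0) else 0) = π ∧ (fun j : Fin n => if N ≤ (j : ℕ) then ∑ i ∈ Finset.range N, (if h : i < n then MvPolynomial.coeff (Finsupp.single (⟨i, h⟩ : Fin n) 1 + Finsupp.single j 1) P else 0) * (if Nat.testBit (q * T) i then (1 : ZMod 2) else 0) else 0) = π')),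
            (if (((∑ i ∈ Finset.range N, ∑ j ∈ Finset.range N, (if i < j then (if h : i < n ∧ j < n then MvPolynomial.coeff (Finsupp.single (⟨i, h.1⟩ : Fin n) 1 + Finsupp.single (⟨j, h.2⟩ : Fin n) 1) P else 0) * (if Nat.testBit (p * T) i then (1 : ZMod 2) else 0) * (if Nat.testBit (p * T) j then (1 : ZMod 2) else 0) else 0)) + ∑ i ∈ Finset.range N, (if h : i < n then MvPolynomial.coeff (Finsupp.single (⟨i, h⟩ : Fin n) 1) P + MvPolynomial.coeff (Finsupp.single (⟨i, h⟩ : Fin n) 2) P else 0) * (if Nat.testBit (p * T) i then (1 : ZMod 2) else 0)) + ((∑ i ∈ Finset.range N, ∑ j ∈ Finset.range N, (if i < j then (if h : i < n ∧ j < n then MvPolynomial.coeff (Finsupp.single (⟨i, h.1⟩ : Fin n) 1 + Finsupp.single (⟨j, h.2⟩ : Fin n) 1) P else 0) * (if Nat.testBit (q * T) i then (1 : ZMod 2) else 0) * (if Nat.testBit (q * T) j then (1 : ZMod 2) else 0) else 0)) + ∑ i ∈ Finset.range N, (if h : i < n then MvPolynomial.coeff (Finsupp.single (⟨i, h⟩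 : Fin n) 1) P + MvPolynomial.coeff (Finsupp.single (⟨i, h⟩ : Fin n) 2) P else 0) * (if Nat.testBit (q * T) i then (1 : ZMod 2) else 0))) = 1 then (-1 : ℝ) else 1)|))
    (hUwc : ∀ p q : ℕ, p.Prime → q.Prime → p ≠ q → 2 < p → 2 < q → ∀ R₀ : ℕ, ∀ δ : ℝ, 0 < δ → ∃ s g : ℕ,
      ∀ (n N : ℕ) (P : MvPolynomial (Fin n) (ZMod 2)), N ≤ n → (∀ c : ℕ, (Matrix.of fun (i j : Fin n) => if (i : ℕ) < c ∧ c ≤ (j : ℕ) then MvPolynomial.coeff (Finsupp.single i 1 + Finsupp.single j 1) P else 0).rank < R₀) →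
      (∃ b k : ℕ → ℕ, (∀ t, t < g → b t < k t ∧ k t < N ∧ s < k t - b t ∧ ∀ (hb : b t < n) (hk : k t < n), MvPolynomial.coeff (Finsupp.single (⟨b t, hb⟩ : Fin n) 1 + Finsupp.single (⟨k t, hk⟩ : Fin n) 1) P ≠ 0) ∧
        (∀ t, t + 1 < g → k t ≤ b (t + 1))) →
      (∑ x ∈ Finset.range p ×ˢ Finset.range q, ∑ π : Fin n → ZMod 2, ∑ π' : Fin n → ZMod 2,
          |∑ T ∈ (Finset.range (2 ^ N)).filter (fun T => (p * T / 2 ^ N = x.1 ∧ q * T / 2 ^ N = x.2 ∧ (fun j : Fin n => if N ≤ (j : ℕ) then ∑ i ∈ Finset.range N, (if h : i < n then MvPolynomial.coeff (Finsupp.single (⟨i, h⟩ : Fin n) 1 + Finsupp.single j 1) P else 0) * (if Nat.testBit (p * T) i then (1 : ZMod 2) else 0) else 0) = π ∧ (fun j : Fin n => if N ≤ (j : ℕ) then ∑ i ∈ Finset.range N, (if h : i < n then MvPolynomial.coeff (Finsupp.single (⟨i, h⟩ : Fin n) 1 + Finsupp.single j 1) P else 0) * (if Nat.testBit (q * T)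 i then (1 : ZMod 2) else 0) else 0) = π')),
            (if (((∑ i ∈ Finset.range N, ∑ j ∈ Finset.range N, (if i < j then (if h : i < n ∧ j < n then MvPolynomial.coeff (Finsupp.single (⟨i, h.1⟩ : Fin n) 1 + Finsupp.single (⟨j, h.2⟩ : Fin n) 1) P else 0) * (if Nat.testBit (p * T) i then (1 : ZMod 2) else 0) * (if Nat.testBit (p * T) j then (1 : ZMod 2) else 0) else 0)) + ∑ i ∈ Finset.range N, (if h : i < n then MvPolynomial.coeff (Finsupp.single (⟨i, h⟩ : Fin n) 1) P + MvPolynomial.coeff (Finsupp.single (⟨i, h⟩ : Fin n) 2) P else 0) * (if Nat.testBit (p * T) i then (1 : ZMod 2) else 0)) + ((∑ i ∈ Finset.range N, ∑ j ∈ Finset.range N, (if i < j then (if h : i < n ∧ j < n then MvPolynomial.coeff (Finsupp.single (⟨i, h.1⟩ : Fin n) 1 + Finsupp.single (⟨j, h.2⟩ : Fin n) 1) P else 0) * (if Nat.testBit (q * T) i then (1 : ZMod 2) else 0) * (if Nat.testBit (q * T) j then (1 : ZMod 2) else 0) else 0)) + ∑ i ∈ Finset.range N, (if h : i < n then MvPolynomial.coeff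 (Finsupp.single (⟨i, h⟩ : Fin n) 1) P + MvPolynomial.coeff (Finsupp.single (⟨i, h⟩ : Fin n) 2) P else 0) * (if Nat.testBit (q * T) i then (1 : ZMod 2) else 0))) = 1 then (-1 : ℝ) else 1)|) ≤ δ * (2 : ℝ) ^ N)
    (hStruct : ∀ (n R₀ R s : ℕ) (P : MvPolynomial (Fin n) (ZMod 2)), P.totalDegree ≤ 2 → (∀ c : ℕ, (Matrix.of fun (i j : Fin n) => if (i : ℕ) < c ∧ c ≤ (j : ℕ) then MvPolynomial.coeff (Finsupp.single i 1 + Finsupp.single j 1) P else 0).rank < R₀) → ¬ (∃ Q : MvPolynomial (Fin n) (ZMod 2), Q.totalDegree ≤ 2 ∧ (∀ m ∈ Q.support, ∀ i ∈ m.support, ∀ j ∈ m.support, Nat.dist i j ≤ s) ∧ ∃ k : ℕ, k < R ∧ ∃ u v : Fin k → Fin n → ZMod 2, ∀ x : Fin n → ZMod 2, MvPolynomial.eval x P = MvPolynomial.eval x Q + ∑ t : Fin k, (∑ i : Fin n, u t i * x i) * (∑ i : Fin n, v t i * x i)) →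
      ∃ (g : ℕ) (b k : ℕ → ℕ), R ≤ R₀ * g ∧
        (∀ t, t < g → b t < k t ∧ k t < n ∧ s < k t - b t ∧ ∀ (hb : b t < n) (hk : k t < n), MvPolynomial.coeff (Finsupp.single (⟨b t, hb⟩ : Fin n) 1 + Finsupp.single (⟨k t, hk⟩ : Fin n) 1) P ≠ 0) ∧
        (∀ t, t + 1 < g → k t ≤ b (t + 1)) ∧
        (∀ t, t < g → ∀ b' k' : Fin n, (t = 0 ∨ k (t - 1) ≤ (b' : ℕ)) → (b' : ℕ) < k' → s < (k' : ℕ) - b' →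
          MvPolynomial.coeff (Finsupp.single b' 1 + Finsupp.single k' 1) P ≠ 0 → k t ≤ k')) :
    ∀ B : ℕ, ∀ τ : ℝ, 0 < τ → ∀ R₀ : ℕ, ∃ R s : ℕ, ∀ n : ℕ, ∀ P : MvPolynomial (Fin n) (ZMod 2), P.totalDegree ≤ 2 → (∀ c : ℕ, (Matrix.of fun (i j : Fin n) => if (i : ℕ) < c ∧ c ≤ (j : ℕ) then MvPolynomial.coeff (Finsupp.single i 1 + Finsupp.single j 1) P else 0).rank < R₀) → ¬ (∃ Q : MvPolynomial (Fin n) (ZMod 2), Q.totalDegree ≤ 2 ∧ (∀ m ∈ Q.support, ∀ i ∈ m.support, ∀ j ∈ m.support, Nat.dist i j ≤ s) ∧ ∃ k : ℕ, k < R ∧ ∃ u v : Fin k → Fin n → ZMod 2, ∀ x : Fin n → ZMod 2, MvPolynomial.eval x P = MvPolynomial.eval x Q + ∑ t : Fin k, (∑ i : Fin n, u t i * x i) * (∑ i : Fin n, v t i * x i)) → ∀ p q : ℕ, p.Prime → q.Prime → p ≠ q → 2 < p → 2 < q → p ≤ B → q ≤ B → ∀ M : ℕ, M ≤ 2 ^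 n → 2 ^ n ≤ 2 * B * M → |∑ m ∈ Icc 1 M, (if MvPolynomial.eval (fun i : Fin n => if Nat.testBit (p * m) i then (1 : ZMod 2) else 0) P = 1 then (-1 : ℝ) else 1) * (if MvPolynomial.eval (fun i : Fin n => if Nat.testBit (q * m) i then (1 : ZMod 2) else 0) P = 1 then (-1 : ℝ) else 1)| ≤ τ * M := by
  intro B τ hτ R₀
  exact stub_lowCutKatai_abs
    (fun n P p m => (if MvPolynomial.eval (fun i : Fin n => if Nat.testBit (p * m) i then (1 : ZMod 2) else 0) P = 1
      then (-1 : ℝ) else 1))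
    _ _ _
    (fun n P b k => ∀ (hb : b < n) (hk : k < n),
      MvPolynomial.coeff (Finsupp.single (⟨b, hb⟩ : Fin n) 1 + Finsupp.single (⟨k, hk⟩ : Fin n) 1) P ≠ 0)
    (fun n P p m => by
      show |(if _ then (-1 : ℝ) else 1)| ≤ 1
      split_ifs <;> simp)
    hBlock hUwc
    (fun n R₀ R s P hP hc hl => by
      obtain ⟨g, b, k, h1, h2, h3, -⟩ := hStruct n R₀ R s P hP hc hl
      exact ⟨g, b, k, h1, h2, h3⟩)
    B τ hτ R₀

end Summit.QuantumAdvantage.QuantumAdvantage.Theorems.MobiusLadderQuadraticDigitPhasesStubLowCutKataiAsm
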